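import Summits.BirchSwinnertonDyer.BirchSwinnertonDyer.Theorems.AlignedTransportAtTwoMainConjectureTransportAlignedAtTwoMuCertificate
import Summits.BirchSwinnertonDyer.BirchSwinnertonDyer.Theorems.AlignedTransportAtTwoMainConjectureTransportAlignedAtTwoSigmaSymbolParity
import HarnessLib

/-!
# Route `AlignedTransportAtTwo`, crux C1 `MainConjectureTransportAlignedAtTwo` (stmt-BirchSwinnertonDyer-22296), line `birth` —
# the raw Σ-depleted identity is EQUIVALENT to a MEASURE-LEVEL parity law on the classes `5ˢ mod 2^{n+2}` (so the line's open stub is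
# pinned exactly; the termwise symbol law of v8/v9 is stronger only through the base values of the tables)

HONEST FRAMING (cell `bsd-f1-sign2`, lead seat `bsd-line-att-p1` g3). BSD is NOT proved here and C1 is NOT closed here. For an aligned pair as in
the crux (here: any two globally minimal curves good ordinary at `2` without rational `2`-torsion, newforms `f₁, f₂`, even-branch lifts `G₁, G₂`)
and a list `l` of odd places, let `Dᵢ = eulerDepleteList Wᵢ 2 l μ_{fᵢ,αᵢ}` be the Σ-depleted Mazur–Swinnerton-Dyer measures (Literature
`GreenbergVatsal2000.EulerFactorDepletion`; `Dᵢ(a + 2^{m+1}ℤ₂) = αᵢ^{−(m+1)}Φᵢ(a/2^{m+1}) − αᵢ^{−(m+2)}Φᵢ(a/2^m)`, `Φᵢ` the depleted plus-symbol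
tables). THEN (§3, `red_depleted_eq_iff_norm_sub_le_one`):
`red (G₁·∏_{v∈l}𝒫_v^ι(W₁)) = red (G₂·∏_{v∈l}𝒫_v^ι(W₂))`  ⟺  `‖D₁(5ˢ + 2^{n+2}ℤ₂) − D₂(5ˢ + 2^{n+2}ℤ₂)‖₂ ≤ 1` for all `n, s`
(the two depleted measures agree MODULO `ℤ₂` on every class of `Γ = 1 + 4ℤ₂`). ⟸ (§1): an even distribution that is `ℤ₂`-valued on the classes of
`Γ` has all transform coefficients in `2ℤ₂` (`Δ = {±1}`-doubling; only the `Γ`-classes enter the Riemann sums). ⟹ (§2): the `μ = 0` certificate at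
`2` (`AlignedTransportAtTwoMuCertificate.exists_lt_norm_coeff_of_lt_norm_apply_two`, via the `Γ`-half distribution and the tree's Lucas/Newton
certificate) applied to `D₁ − D₂`: a value of norm `2` would force a transform coefficient outside `2ℤ₂`. So the open stub of line `birth`
(`SymbolLineTransferAtTwoSigmaRawS3`, v7; implied by the termwise law `SigmaDepletedSymbolParityAtTwoS3`, v9) is EXACTLY this measure-level parity
law, instance by instance — a statement about finitely many rational modular symbols per class. Everything is proved; nothing asserted.
`--supports stmt-BirchSwinnertonDyer-22296`; closes nothing.

References: [MazurTateTeitelbaum1986Invent] §I.10 (10.1), §I.11–I.13; [EmertonPollackWeston2006] §3, Thm. 3.6.2; [GreenbergVatsal2000] §1 (8)–(10).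
-/

set_option autoImplicit false
set_option linter.dupNamespace false

noncomputable section

open scoped Classical MatrixGroups ModularForm

open CongruenceSubgroup Filter Topology WeierstrassCurve NumberField IsDedekindDomain
open Literature.NumberTheory.EllipticCurves Literature.NumberTheory.EllipticCurves.ModularForms
open Literature.NumberTheory.EllipticCurves.Greenberg1999
open Literature.NumberTheory.EllipticCurves.GreenbergVatsal2000
open Summit.BirchSwinnertonDyer.Rank1Residual.X1.MuLambda
open Summit.BirchSwinnertonDyer.Rank1Residual.F1Sign2
open Summit.BirchSwinnertonDyer.BirchSwinnertonDyer.Theorems.AlignedTransportAtTwoSigmaGlue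
open Summit.BirchSwinnertonDyer.BirchSwinnertonDyer.Theorems.AlignedTransportAtTwoSymbolParity
open Summit.BirchSwinnertonDyer.BirchSwinnertonDyer.Theorems.AlignedTransportAtTwoMuCertificate

namespace Summit.BirchSwinnertonDyer.BirchSwinnertonDyer.Theorems.AlignedTransportAtTwoSigmaMeasureParity

/-! ## §1 Even distributions `ℤ₂`-valued on `Γ` have transform in `2·(ℤ₂-coefficients)` -/

section Even

variable {Δ : (n : ℕ) → ZMod (2 ^ n) → ℚ_[2]}

/-- **An even distribution on `ℤ₂` which is `ℤ₂`-valued on the classes `5ˢ mod 2^{n+2}` of `Γ` has every transform coefficient in `2ℤ₂`**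
(given the distribution relation and SOME bound, for convergence): the Riemann sums are `2·∑_s Δ(5ˢ)·C(s,k)` (`Δ = {±1}`-doubling).
[cite: MazurTateTeitelbaum1986Invent, §I.13 (p = 2: Δ = {±1}, γ = 5)] -/
theorem norm_coeff_le_half_of_even_of_gamma (heven : ∀ (n : ℕ) (a : ZMod (2 ^ n)), Δ n (-a) = Δ n a)
    (hdist : ∀ (n : ℕ) (a : ZMod (2 ^ n)),
      ∑ b ∈ Finset.univ.filter (fun b : ZMod (2 ^ (n + 1)) ↦
        ZMod.castHom (pow_dvd_pow 2 n.le_succ) (ZMod (2 ^ n)) b = a), Δ (n + 1) b = Δ n a)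
    {C : ℝ} (hC : ∀ (n : ℕ) (a : ZMod (2 ^ n)), ‖Δ n a‖ ≤ C)
    (hΓ : ∀ (n : ℕ) (s : ZMod (2 ^ n)), ‖Δ (n + 2) ((cyclotomicGenerator 2 : ZMod (2 ^ (n + 2))) ^ s.val)‖ ≤ 1) (k : ℕ) :
    ‖PowerSeries.coeff k (distributionTransform Δ)‖ ≤ 2⁻¹ := by
  have norm_two : ‖(2 : ℚ_[2])‖ = (2 : ℝ)⁻¹ := by simpa using Padic.norm_p (p := 2)
  have hRS : ∀ n, ‖distributionRiemannSum Δ k n‖ ≤ 2⁻¹ := fun n ↦ by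
    rw [distributionRiemannSum_two_of_even heven k n, norm_mul, norm_two]
    have h : ‖∑ s : ZMod (2 ^ n), Δ (n + 2) ((cyclotomicGenerator 2 : ZMod (2 ^ (n + 2))) ^ s.val) *
        ((s.val.choose k : ℕ) : ℚ_[2])‖ ≤ 1 :=
      IsUltrametricDist.norm_sum_le_of_forall_le_of_nonneg zero_le_one fun s _ ↦ by
        rw [norm_mul]
        have h1 : ‖((s.val.choose k : ℕ) : ℚ_[2])‖ ≤ 1 := by exact_mod_cast Padic.norm_int_le_one ((s.val.choose k : ℕ) : ℤ)
        calc _ ≤ (1 : ℝ) * 1 := mul_le_mul (hΓ n s) h1 (norm_nonneg _) zero_le_one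
          _ = 1 := one_mul _
    calc (2 : ℝ)⁻¹ * _ ≤ 2⁻¹ * 1 := by gcongr
      _ = 2⁻¹ := mul_one _
  exact le_of_tendsto (tendsto_distributionRiemannSum hdist hC k).norm (Eventually.of_forall hRS)

end Even

/-! ## §2 Equal reductions force coefficientwise congruence -/

/-- If `red X₁ = red X₂` in `𝔽₂⟦T⟧` then every coefficient of `ι X₁ − ι X₂` lies in `2ℤ₂` (converse of `red_eq_of_norm_coeff_sub_le_half`).
[folklore] -/
theorem norm_coeff_sub_le_half_of_red_eq {X₁ X₂ : IwasawaAlgebra 2} (h : red X₁ = red X₂) (k : ℕ) :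
    ‖PowerSeries.coeff k (iwasawaToPowerSeries 2 X₁) - PowerSeries.coeff k (iwasawaToPowerSeries 2 X₂)‖ ≤ 2⁻¹ := by
  have h0 : red (X₁ - X₂) = 0 := by
    have := map_sub (PowerSeries.map (IsLocalRing.residue ℤ_[2])) X₁ X₂
    change red (X₁ - X₂) = red X₁ - red X₂ at this
    rw [this, h, sub_self]
  have hk : PowerSeries.coeff k (red (X₁ - X₂)) = 0 := by rw [h0, map_zero]
  rw [PowerSeries.coeff_map, IsLocalRing.residue_eq_zero_iff, IsLocalRing.mem_maximalIdeal, PadicInt.mem_nonunits] at hk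
  rw [PowerSeries.coeff_map, PowerSeries.coeff_map, PadicInt.algebraMap_apply, PadicInt.algebraMap_apply, ← PadicInt.coe_sub,
    PadicInt.padic_norm_e_of_padicInt, ← map_sub]
  exact norm_le_half_of_norm_lt_one hk

/-! ## §3 The raw Σ-depleted identity of a pair ⟺ parity of the depleted measures on the classes of `Γ` -/

section Pair

variable {N₁ N₂ : ℕ} [NeZero N₁] [NeZero N₂] {f₁ : CuspForm (Gamma0 N₁) 2} {f₂ : CuspForm (Gamma0 N₂) 2}
  (W₁ : WeierstrassCurve ℚ) [W₁.IsElliptic] [W₁.IsGloballyMinimal]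
  (W₂ : WeierstrassCurve ℚ) [W₂.IsElliptic] [W₂.IsGloballyMinimal]

/-- **RAW Σ-DEPLETED IDENTITY ⟺ MEASURE-LEVEL PARITY ON `Γ` (p = 2).** Let `W₁, W₂/ℚ` be globally minimal, good ordinary at `2`, without
rational point of order `2`, with newforms `f₁, f₂`, even-branch lifts `G₁, G₂`, and let `l` be a list of odd places. With the Σ-depleted
Mazur–Swinnerton-Dyer measures `Dᵢ = eulerDepleteList Wᵢ 2 l μ_{fᵢ,αᵢ}`:
`red (G₁·∏_{v∈l}𝒫_v^ι(W₁)) = red (G₂·∏_{v∈l}𝒫_v^ι(W₂)) ↔ ∀ n s, ‖D₁(5ˢ + 2^{n+2}ℤ₂) − D₂(5ˢ + 2^{n+2}ℤ₂)‖ ≤ 1`.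
(⟸: §1 for the even distribution `D₁ − D₂`; ⟹: the `μ = 0` certificate at `2` for `D₁ − D₂` and §2.) The values `Dᵢ(a + 2^{m+1}ℤ₂)` are the
Mazur–Swinnerton-Dyer expressions `αᵢ^{−(m+1)}Φᵢ(a/2^{m+1}) − αᵢ^{−(m+2)}Φᵢ(a/2^m)` in the depleted tables (`eulerDepleteList_msdMeasure_succ`).
[cite: MazurTateTeitelbaum1986Invent, §I.10 (10.1), §I.11–I.13] [cite: EmertonPollackWeston2006, §3 and Thm. 3.6.2] -/
theorem red_depleted_eq_iff_norm_sub_le_one (hord₁ : IsOrdinaryAt W₁ 2) (hord₂ : IsOrdinaryAt W₂ 2)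
    (ht₁ : ∀ x : ℚ, ¬ HasRationalTwoTorsionX W₁ x) (ht₂ : ∀ x : ℚ, ¬ HasRationalTwoTorsionX W₂ x)
    (hf₁ : IsNewformOf W₁ f₁) (hf₂ : IsNewformOf W₂ f₂)
    (l : List (HeightOneSpectrum (𝓞 ℚ))) (hl : ∀ v ∈ l, Rat.HeightOneSpectrum.natGenerator v ≠ 2)
    {G₁ G₂ : IwasawaAlgebra 2} (hG₁ : IsEvenBranchLiftAtTwo W₁ f₁ G₁) (hG₂ : IsEvenBranchLiftAtTwo W₂ f₂ G₂) :
    red (G₁ * (l.map (eulerFactorElementInv W₁ 2)).prod) = red (G₂ * (l.map (eulerFactorElementInv W₂ 2)).prod) ↔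
      ∀ (n : ℕ) (s : ZMod (2 ^ n)),
        ‖eulerDepleteList W₁ 2 l (msdMeasure f₁ (unitRoot W₁ 2 : ℚ_[2])) (n + 2) ((cyclotomicGenerator 2 : ZMod (2 ^ (n + 2))) ^ s.val) -
            eulerDepleteList W₂ 2 l (msdMeasure f₂ (unitRoot W₂ 2 : ℚ_[2])) (n + 2) ((cyclotomicGenerator 2 : ZMod (2 ^ (n + 2))) ^ s.val)‖ ≤ 1 := by
  have hι₁ := iwasawaToPowerSeries_eq_of_isEvenBranchLiftAtTwo_of_isOrdinaryAt W₁ hord₁ hG₁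
  have hι₂ := iwasawaToPowerSeries_eq_of_isEvenBranchLiftAtTwo_of_isOrdinaryAt W₂ hord₂ hG₂
  have hirr₁ := AlignedTransportAtTwoClosure.irr_two_of_forall_not_hasRationalTwoTorsionX W₁ ht₁
  have hirr₂ := AlignedTransportAtTwoClosure.irr_two_of_forall_not_hasRationalTwoTorsionX W₂ ht₂
  obtain ⟨n₁, h2n₁, h01⟩ := exists_intCast_mul_modularSymbol_zero_mem (p := 2) not_irreducible_of_frobeniusTrace_congr_holds hf₁ hirr₁
  obtain ⟨n₂, h2n₂, h02⟩ := exists_intCast_mul_modularSymbol_zero_mem (p := 2) not_irreducible_of_frobeniusTrace_congr_holds hf₂ hirr₂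
  obtain ⟨hdD₁, hbD₁, htD₁⟩ := eulerDepleteList_spec W₁ l hl (msdMeasure_distribution_of_isNewformOf hord₁ hf₁)
    (norm_msdMeasure_two_le_two hord₁ hf₁ h2n₁ h01)
  obtain ⟨hdD₂, hbD₂, htD₂⟩ := eulerDepleteList_spec W₂ l hl (msdMeasure_distribution_of_isNewformOf hord₂ hf₂)
    (norm_msdMeasure_two_le_two hord₂ hf₂ h2n₂ h02)
  have heD₁ := eulerDepleteList_neg W₁ (p := 2) l (msdMeasure_neg f₁ (unitRoot W₁ 2 : ℚ_[2]))
  have heD₂ := eulerDepleteList_neg W₂ (p := 2) l (msdMeasure_neg f₂ (unitRoot W₂ 2 : ℚ_[2]))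
  set D₁ := eulerDepleteList W₁ 2 l (msdMeasure f₁ (unitRoot W₁ 2 : ℚ_[2])) with hD₁
  set D₂ := eulerDepleteList W₂ 2 l (msdMeasure f₂ (unitRoot W₂ 2 : ℚ_[2])) with hD₂
  -- restate the four facts for the abbreviations (instance-robust)
  have hdD₁' : ∀ (n : ℕ) (a : ZMod (2 ^ n)),
      ∑ b ∈ Finset.univ.filter (fun b : ZMod (2 ^ (n + 1)) ↦
        ZMod.castHom (pow_dvd_pow 2 n.le_succ) (ZMod (2 ^ n)) b = a), D₁ (n + 1) b = D₁ n a := hdD₁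
  have hdD₂' : ∀ (n : ℕ) (a : ZMod (2 ^ n)),
      ∑ b ∈ Finset.univ.filter (fun b : ZMod (2 ^ (n + 1)) ↦
        ZMod.castHom (pow_dvd_pow 2 n.le_succ) (ZMod (2 ^ n)) b = a), D₂ (n + 1) b = D₂ n a := hdD₂
  have hbD₁' : ∀ (n : ℕ) (a : ZMod (2 ^ n)), ‖D₁ n a‖ ≤ 2 := hbD₁
  have hbD₂' : ∀ (n : ℕ) (a : ZMod (2 ^ n)), ‖D₂ n a‖ ≤ 2 := hbD₂
  have heD₁' : ∀ (n : ℕ) (a : ZMod (2 ^ n)), D₁ n (-a) = D₁ n a := heD₁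
  have heD₂' : ∀ (n : ℕ) (a : ZMod (2 ^ n)), D₂ n (-a) = D₂ n a := heD₂
  have hT₁ : distributionTransform D₁ = iwasawaToPowerSeries 2 (G₁ * (l.map (eulerFactorElementInv W₁ 2)).prod) := by
    rw [show distributionTransform D₁ = _ from htD₁, ← padicLFunction_eq_distributionTransform, ← hι₁, map_mul, mul_comm]
  have hT₂ : distributionTransform D₂ = iwasawaToPowerSeries 2 (G₂ * (l.map (eulerFactorElementInv W₂ 2)).prod) := by
    rw [show distributionTransform D₂ = _ from htD₂, ← padicLFunction_eq_distributionTransform, ← hι₂, map_mul, mul_comm]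
  -- the even distribution `Δ = D₁ − D₂`, bounded by `2`
  set Δ : (n : ℕ) → ZMod (2 ^ n) → ℚ_[2] := D₁ + (-1 : ℚ_[2]) • D₂ with hΔ
  have hΔapply : ∀ (n : ℕ) (a : ZMod (2 ^ n)), Δ n a = D₁ n a - D₂ n a := fun n a ↦ by
    simp only [hΔ, Pi.add_apply, Pi.smul_apply, smul_eq_mul, neg_one_mul, sub_eq_add_neg]
  have hdνD₂ : ∀ (n : ℕ) (a : ZMod (2 ^ n)),
      ∑ b ∈ Finset.univ.filter (fun b : ZMod (2 ^ (n + 1)) ↦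
        ZMod.castHom (pow_dvd_pow 2 n.le_succ) (ZMod (2 ^ n)) b = a), ((-1 : ℚ_[2]) • D₂) (n + 1) b = ((-1 : ℚ_[2]) • D₂) n a :=
    fun n a ↦ by simp only [Pi.smul_apply, smul_eq_mul, ← Finset.mul_sum, hdD₂' n a]
  have hbνD₂ : ∀ (n : ℕ) (a : ZMod (2 ^ n)), ‖((-1 : ℚ_[2]) • D₂) n a‖ ≤ 2 := fun n a ↦ by
    simp only [Pi.smul_apply, smul_eq_mul, norm_mul, norm_neg, norm_one, one_mul]; exact hbD₂' n a
  have hdΔ : ∀ (n : ℕ) (a : ZMod (2 ^ n)),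
      ∑ b ∈ Finset.univ.filter (fun b : ZMod (2 ^ (n + 1)) ↦
        ZMod.castHom (pow_dvd_pow 2 n.le_succ) (ZMod (2 ^ n)) b = a), Δ (n + 1) b = Δ n a := fun n a ↦ by
    simp only [hΔapply, Finset.sum_sub_distrib]; rw [hdD₁' n a, hdD₂' n a]
  have heΔ : ∀ (n : ℕ) (a : ZMod (2 ^ n)), Δ n (-a) = Δ n a := fun n a ↦ by rw [hΔapply, hΔapply, heD₁', heD₂']
  have hbΔ : ∀ (n : ℕ) (a : ZMod (2 ^ n)), ‖Δ n a‖ ≤ 2 := fun n a ↦ by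
    rw [hΔapply, sub_eq_add_neg]
    exact (Padic.nonarchimedean _ _).trans (max_le (hbD₁' n a) (by rw [norm_neg]; exact hbD₂' n a))
  have hTΔ : distributionTransform Δ = distributionTransform D₁ - distributionTransform D₂ := by
    rw [hΔ, distributionTransform_add hdD₁' hbD₁' hdνD₂ hbνD₂, distributionTransform_smul (-1 : ℚ_[2]) hdD₂' hbD₂', map_neg, map_one,
      neg_one_mul, sub_eq_add_neg]
  have norm_two : ‖(2 : ℚ_[2])‖ = (2 : ℝ)⁻¹ := by simpa using Padic.norm_p (p := 2)
  constructor
  · -- ⟹: a class with `‖Δ‖ = 2` would give a coefficient of `L_Δ` outside `2ℤ₂`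
    intro hred n s
    by_contra hgt
    push Not at hgt
    rw [← hΔapply] at hgt
    have hs : (2 : ℝ) * (2 : ℝ)⁻¹ < ‖Δ (n + 2) ((cyclotomicGenerator 2 : ZMod (2 ^ (n + 2))) ^ s.val)‖ := by norm_num; exact hgt
    obtain ⟨k, -, hk⟩ := exists_lt_norm_coeff_of_lt_norm_apply_two heΔ hdΔ hbΔ hs
    set c : ℚ_[2] := PowerSeries.coeff k (iwasawaToPowerSeries 2 (G₁ * (l.map (eulerFactorElementInv W₁ 2)).prod)) -
      PowerSeries.coeff k (iwasawaToPowerSeries 2 (G₂ * (l.map (eulerFactorElementInv W₂ 2)).prod)) with hc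
    have hcoeff : PowerSeries.coeff k (distributionTransform Δ) = c := by rw [hTΔ, map_sub, hT₁, hT₂]
    have hnorm : ‖(2 : ℚ_[2])⁻¹ * PowerSeries.coeff k (distributionTransform Δ)‖ = 2 * ‖c‖ := by
      rw [hcoeff, norm_mul, norm_inv, norm_two, inv_inv]
    rw [hnorm] at hk
    have hle : ‖c‖ ≤ 2⁻¹ := norm_coeff_sub_le_half_of_red_eq hred k
    norm_num at hk
    linarith
  · -- ⟸: §1 for `Δ`
    intro hΓ
    refine red_eq_of_norm_coeff_sub_le_half fun k ↦ ?_
    rw [← hT₁, ← hT₂, ← map_sub, ← hTΔ]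
    exact norm_coeff_le_half_of_even_of_gamma heΔ hdΔ hbΔ (fun n s ↦ by rw [hΔapply]; exact hΓ n s) k

end Pair

end Summit.BirchSwinnertonDyer.BirchSwinnertonDyer.Theorems.AlignedTransportAtTwoSigmaMeasureParity

end
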